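import Literature.AlgebraicGeometry.Modules.LineBundleOfCocycleClass
import Literature.AlgebraicGeometry.Modules.FrameTransition
import HarnessLib

/-!
# The finite locally free module glued from a cocycle of invertible matrices

For a scheme `X`, a family of opens `𝓤 = (U_a)_{a ∈ ι}`, finite index types `I_a` and matrices
`g_{ab} ∈ M_{I_a × I_b}(Γ(X, V))` for all opens `V ≤ U_a ⊓ U_b`, compatible with restriction and
satisfying the cocycle condition `g_{ab} g_{bc} = g_{ac}`, `g_{aa} = 1` (`MatrixCocycle`), we
construct the `𝒪_X`-module `glued c` obtained by gluing the free modules `𝒪_{U_a}^{n_a}` along the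
`g_{ab}` (Hartshorne II Ex. 1.22 (glueing sheaves); II Ex. 5.18 / p. 128 (a locally free sheaf is
determined by transition matrices satisfying the cocycle condition); Stacks Tag 00AK), concretely:

  `Γ(glued c, V) = { (s_a)_a : s_a ∈ Γ(X, V ⊓ U_a)^{n_a}, s_a = g_{ab} s_b on every V' ≤ V ⊓ U_a ⊓ U_b }`

(restriction componentwise; the sheaf condition is checked componentwise with the sheaf `𝒪_X`).
This is the rank-`n` version of `Modules/LineBundleOfCocycle.lean` (cocycles of units, line
bundles). Over `U_b` the module is free on the **column sections** `t_{b,k} = (g_{ab} e_k)_a`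
(`gen`), every section over `V ≤ U_b` being `∑_k (s_b)_k t_{b,k}` (`eq_sum_smul_gen`). The frames
`𝒪^{n_b} ≅ (glued c)|_{U_b}` on the column sections, their transition matrices (the `g_{ab}` again)
and the finite local freeness of `glued c` are in `Modules/MatrixCocycleFrame.lean`. Everything is
proved; no named facts.

## References

* R. Hartshorne, *Algebraic Geometry*, GTM 52 (1977), II Ex. 1.22, II Ex. 5.18. [Hartshorne1977]
* The Stacks Project, Tag 00AK (glueing sheaves), Tag 01C6. [StacksProject]
-/

noncomputable section

open CategoryTheory AlgebraicGeometry Opposite TopologicalSpace Limits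

namespace Literature.AlgebraicGeometry.Modules

open Literature.AlgebraicGeometry.Motives

universe u

variable {X : Scheme.{u}} {ι : Type u}

variable (X ι) in
/-- **A Čech `1`-cocycle of invertible matrices** on a family of opens `(U_a)_{a ∈ ι}` of a scheme
`X`: finite index types `I_a` (ranks `n_a = |I_a|`), matrices `g_{ab} ∈ M_{I_a × I_b}(Γ(X, V))` for all opens `V ≤ U_a ⊓ U_b`,
compatible with restriction, with `g_{ab} g_{bc} = g_{ac}` and `g_{aa} = 1` (the transition data of
a locally free sheaf, Hartshorne II Ex. 5.18). [folklore] -/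
structure MatrixCocycle where
  /-- The open `U_a`. -/
  U : ι → X.Opens
  /-- The (finite) index type `I_a` of the basis over `U_a` (rank `n_a = |I_a|`). -/
  I : ι → Type u
  /-- The index types are finite. -/
  [instFintype : ∀ a, Fintype (I a)]
  /-- The index types have decidable equality. -/
  [instDecidableEq : ∀ a, DecidableEq (I a)]
  /-- The transition matrix `g_{ab}` over an open `V ≤ U_a ⊓ U_b`. -/
  g : ∀ (a b : ι) (V : X.Opens), V ≤ U a → V ≤ U b → Matrix (I a) (I b) Γ(X, V)
  /-- Compatibility with restriction. -/
  map_g : ∀ (a b : ι) {V V' : X.Opens} (ha : V ≤ U a) (hb : V ≤ U b) (i : V' ≤ V),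
    (g a b V ha hb).map (secRes X i) = g a b V' (i.trans ha) (i.trans hb)
  /-- The cocycle condition `g_{ab} g_{bd} = g_{ad}`. -/
  g_mul : ∀ (a b d : ι) (V : X.Opens) (ha : V ≤ U a) (hb : V ≤ U b) (hd : V ≤ U d),
    g a b V ha hb * g b d V hb hd = g a d V ha hd
  /-- `g_{aa} = 1`. -/
  g_self : ∀ (a : ι) (V : X.Opens) (ha : V ≤ U a), g a a V ha ha = 1

attribute [instance] MatrixCocycle.instFintype MatrixCocycle.instDecidableEq

namespace MatrixCocycle

variable (c : MatrixCocycle X ι)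

/-- Entries of the transition matrices are compatible with restriction. [folklore] -/
lemma map_g_apply (a b : ι) {V V' : X.Opens} (ha : V ≤ c.U a) (hb : V ≤ c.U b) (i : V' ≤ V)
    (j : c.I a) (k : c.I b) :
    secRes X i (c.g a b V ha hb j k) = c.g a b V' (i.trans ha) (i.trans hb) j k := by
  have h := c.map_g a b ha hb i
  exact congrFun (congrFun h j) k

/-- Entries of the cocycle condition: `∑_k (g_{ab})_{jk} (g_{bd})_{kl} = (g_{ad})_{jl}`. [folklore] -/
lemma sum_g_mul_g (a b d : ι) (V : X.Opens) (ha : V ≤ c.U a) (hb : V ≤ c.U b) (hd : V ≤ c.U d)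
    (j : c.I a) (l : c.I d) :
    ∑ k, c.g a b V ha hb j k * c.g b d V hb hd k l = c.g a d V ha hd j l := by
  rw [← c.g_mul a b d V ha hb hd, Matrix.mul_apply]

/-- `g_{ab} g_{ba} = 1`. [folklore] -/
lemma g_mul_symm (a b : ι) (V : X.Opens) (ha : V ≤ c.U a) (hb : V ≤ c.U b) :
    c.g a b V ha hb * c.g b a V hb ha = 1 := by
  rw [c.g_mul, c.g_self]

/-- Entries of `g_{aa} = 1`. [folklore] -/
lemma g_self_apply (a : ι) (V : X.Opens) (ha ha' : V ≤ c.U a) (j k : c.I a) :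
    c.g a a V ha ha' j k = if j = k then 1 else 0 := by
  rw [show c.g a a V ha ha' = c.g a a V ha ha from rfl, c.g_self, Matrix.one_apply]

/-! ### Glue families -/

/-- A family `s_a ∈ Γ(X, V ⊓ U_a)^{n_a}` is a **glue family** if `s_a = g_{ab} s_b` on every open
below `V`, `U_a` and `U_b` (written entrywise). [folklore] -/
def IsGlueFamily (V : X.Opens) (s : ∀ a, c.I a → Γ(X, V ⊓ c.U a)) : Prop :=
  ∀ (a b : ι) (V' : X.Opens) (hV : V' ≤ V) (ha : V' ≤ c.U a) (hb : V' ≤ c.U b) (j : c.I a),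
    secRes X (le_inf hV ha) (s a j) = ∑ k, c.g a b V' ha hb j k * secRes X (le_inf hV hb) (s b k)

/-- The `Γ(X, V)`-module structure on `Γ(X, V ⊓ U_a)` by restriction (local instance). [folklore] -/
@[reducible]
def pieceModule (V : X.Opens) (a : ι) : Module Γ(X, V) Γ(X, V ⊓ c.U a) :=
  Module.compHom _ (secRes X (inf_le_left : V ⊓ c.U a ≤ V))

attribute [local instance] pieceModule

/-- Unfolding the scalar action on a piece. [folklore] -/
lemma piece_smul_def (V : X.Opens) (a : ι) (r : Γ(X, V)) (x : Γ(X, V ⊓ c.U a)) :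
    r • x = secRes X (inf_le_left : V ⊓ c.U a ≤ V) r * x := rfl

/-- **The sections of the glued module over `V`**: the glue families, a submodule of
`∏_a Γ(X, V ⊓ U_a)^{n_a}`. [folklore] -/
def glueSubmodule (V : X.Opens) : Submodule Γ(X, V) (∀ a, c.I a → Γ(X, V ⊓ c.U a)) where
  carrier := {s | c.IsGlueFamily V s}
  zero_mem' a b V' hV ha hb j := by
    simp only [Pi.zero_apply, map_zero, mul_zero, Finset.sum_const_zero]
  add_mem' {s t} hs ht a b V' hV ha hb j := by
    simp only [Pi.add_apply, map_add, hs a b V' hV ha hb j, ht a b V' hV ha hb j, mul_add,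
      Finset.sum_add_distrib]
  smul_mem' r s hs a b V' hV ha hb j := by
    simp only [Pi.smul_apply, piece_smul_def, map_mul, secRes_secRes, hs a b V' hV ha hb j,
      Finset.mul_sum]
    exact Finset.sum_congr rfl fun k _ => by ring

/-- Membership in `glueSubmodule`. [folklore] -/
lemma mem_glueSubmodule_iff (V : X.Opens) (s : ∀ a, c.I a → Γ(X, V ⊓ c.U a)) :
    s ∈ c.glueSubmodule V ↔ c.IsGlueFamily V s := Iff.rfl

/-- Restriction of glue families along `V' ≤ V` (componentwise). [folklore] -/
def glueRestrict {V V' : X.Opens} (i : V' ≤ V) : c.glueSubmodule V →+ c.glueSubmodule V' where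
  toFun s := ⟨fun a j => secRes X (inf_le_inf_right (c.U a) i) (s.1 a j), fun a b W hV ha hb j => by
    simp only [secRes_secRes]
    exact s.2 a b W (hV.trans i) ha hb j⟩
  map_zero' := by
    ext a j
    exact map_zero _
  map_add' s t := by
    ext a j
    exact map_add _ _ _

/-- Components of a restricted glue family. [folklore] -/
@[simp]
lemma glueRestrict_apply {V V' : X.Opens} (i : V' ≤ V) (s : c.glueSubmodule V) (a : ι)
    (j : c.I a) :
    (c.glueRestrict i s).1 a j = secRes X (inf_le_inf_right (c.U a) i) (s.1 a j) := rfl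

/-- Restriction of glue families is semilinear. [folklore] -/
lemma glueRestrict_smul {V V' : X.Opens} (i : V' ≤ V) (r : Γ(X, V)) (s : c.glueSubmodule V) :
    c.glueRestrict i (r • s) = secRes X i r • c.glueRestrict i s := by
  ext a j
  change secRes X _ (secRes X _ r * s.1 a j) = secRes X _ (secRes X i r) * secRes X _ (s.1 a j)
  rw [map_mul, secRes_secRes, secRes_secRes]

/-- **The presheaf of abelian groups `V ↦ {glue families over V}`.** [folklore] -/
def gluePresheafAb : TopCat.Presheaf Ab X where
  obj V := AddCommGrpCat.of (c.glueSubmodule V.unop)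
  map i := AddCommGrpCat.ofHom (c.glueRestrict i.unop.le)
  map_id V := by
    refine AddCommGrpCat.ext fun s => Subtype.ext (funext fun a => funext fun j => ?_)
    exact secRes_self _
  map_comp i j := by
    refine AddCommGrpCat.ext fun s => Subtype.ext (funext fun a => funext fun j => ?_)
    exact (secRes_secRes _ _ _).symm

/-- The restriction maps of `gluePresheafAb`. [folklore] -/
@[simp]
lemma gluePresheafAb_map_apply {V V' : (X.Opens)ᵒᵖ} (i : V ⟶ V') (s : c.glueSubmodule V.unop) :
    (c.gluePresheafAb.map i) s = c.glueRestrict i.unop.le s := rfl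

/-- The presheaf of `𝒪_X`-modules of glue families. [folklore] -/
def gluePresheaf : X.PresheafOfModules :=
  @PresheafOfModules.ofPresheaf _ _ X.ringCatSheaf.obj c.gluePresheafAb
    (fun V => Submodule.module (c.glueSubmodule V.unop))
    (fun _ _ i r s => c.glueRestrict_smul i.unop.le r s)

/-! ### The sheaf condition -/

/-- Gluing glue families: a compatible family of glue families over an open cover glues uniquely
(componentwise, by the sheaf property of `𝒪_X` on the cover `V_l ⊓ U_a` of `(⨆ V_l) ⊓ U_a`).
[folklore] -/
theorem gluePresheafAb_isSheaf : TopCat.Presheaf.IsSheaf c.gluePresheafAb := by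
  rw [TopCat.Presheaf.isSheaf_iff_isSheafUniqueGluing]
  intro κ V sf hsf
  have hcov : ∀ a : ι, (iSup V) ⊓ c.U a ≤ ⨆ l, V l ⊓ c.U a := fun a => by
    rw [← iSup_inf_eq]
  have hcompat : ∀ (a : ι) (j : c.I a), TopCat.Presheaf.IsCompatible X.presheaf
      (fun l => V l ⊓ c.U a) (fun l => (sf l).1 a j) := by
    intro a j l m
    have h := congrArg (fun s : c.glueSubmodule (V l ⊓ V m) => s.1 a j) (hsf l m)
    simp only [gluePresheafAb_map_apply, glueRestrict_apply] at h
    change secRes X _ ((sf l).1 a j) = secRes X _ ((sf m).1 a j)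
    have e₁ : V l ⊓ c.U a ⊓ (V m ⊓ c.U a) ≤ V l ⊓ V m ⊓ c.U a :=
      le_inf (inf_le_inf inf_le_left inf_le_left) (inf_le_left.trans inf_le_right)
    rw [← secRes_secRes (inf_le_inf_right (c.U a) (inf_le_left : V l ⊓ V m ≤ V l)) e₁,
      ← secRes_secRes (inf_le_inf_right (c.U a) (inf_le_right : V l ⊓ V m ≤ V m)) e₁]
    exact congrArg _ h
  choose t ht htu using fun (a : ι) (j : c.I a) =>
    TopCat.Sheaf.existsUnique_gluing' X.sheaf (fun l => V l ⊓ c.U a)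
      ((iSup V) ⊓ c.U a) (fun l => homOfLE (inf_le_inf_right (c.U a) (le_iSup V l))) (hcov a)
      (fun l => (sf l).1 a j) (hcompat a j)
  have ht' : ∀ a j l, secRes X (inf_le_inf_right (c.U a) (le_iSup V l)) (t a j) = (sf l).1 a j := ht
  -- the glued family is a glue family: check the relation locally on `V' ⊓ V_l`
  have hglue : c.IsGlueFamily (iSup V) t := by
    intro a b V' hV ha hb j
    apply TopCat.Sheaf.eq_of_locally_eq' X.sheaf (fun l => V' ⊓ V l) V'
      (fun l => homOfLE inf_le_left)
      (by rw [← inf_iSup_eq]; exact le_inf le_rfl hV)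
    intro l
    change secRes X inf_le_left _ = secRes X inf_le_left _
    rw [map_sum, secRes_secRes]
    simp_rw [map_mul, secRes_secRes, c.map_g_apply]
    have h := (sf l).2 a b (V' ⊓ V l) inf_le_right (inf_le_left.trans ha) (inf_le_left.trans hb) j
    rw [← ht' a j l, secRes_secRes] at h
    simp_rw [← ht' b _ l, secRes_secRes] at h
    exact h
  refine ⟨⟨t, hglue⟩, fun l => Subtype.ext (funext fun a => funext fun j => ht' a j l), ?_⟩
  -- uniqueness
  intro s hs
  refine Subtype.ext (funext fun a => funext fun j => htu a j (s.1 a j) fun l => ?_)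
  exact congrArg (fun s : c.glueSubmodule (V l) => s.1 a j) (hs l)

variable (X) in
/-- The presheaf of modules of glue families is a sheaf. [folklore] -/
lemma gluePresheaf_isSheaf :
    Presheaf.IsSheaf (Opens.grothendieckTopology X) c.gluePresheaf.presheaf :=
  c.gluePresheafAb_isSheaf

/-- **The module glued from a cocycle of invertible matrices** `c = (U_a, n_a, g_{ab})`: the
`𝒪_X`-module of glue families `(s_a ∈ Γ(X, V ⊓ U_a)^{n_a})_a`, `s_a = g_{ab} s_b`
(Hartshorne II Ex. 1.22, II Ex. 5.18). [cite: Hartshorne1977, II Ex. 5.18] -/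
def glued : X.Modules where
  val := c.gluePresheaf
  isSheaf := c.gluePresheafAb_isSheaf

/-! ### Sections of the glued module -/

/-- The `(a, j)`-component `(s_a)_j ∈ Γ(X, V ⊓ U_a)` of a section of the glued module. [folklore] -/
def comp {V : X.Opens} (s : Γ(c.glued, V)) (a : ι) (j : c.I a) : Γ(X, V ⊓ c.U a) :=
  (s : c.glueSubmodule V).1 a j

/-- Sections of the glued module are determined by their components. [folklore] -/
@[ext]
lemma section_ext {V : X.Opens} {s t : Γ(c.glued, V)} (h : ∀ a j, c.comp s a j = c.comp t a j) :
    s = t :=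
  Subtype.ext (funext fun a => funext fun j => h a j)

/-- The glue relation of a section: `s_a = g_{ab} s_b` entrywise over `V' ≤ V ⊓ U_a ⊓ U_b`.
[folklore] -/
lemma comp_rel {V : X.Opens} (s : Γ(c.glued, V)) (a b : ι) (V' : X.Opens) (hV : V' ≤ V)
    (ha : V' ≤ c.U a) (hb : V' ≤ c.U b) (j : c.I a) :
    secRes X (le_inf hV ha) (c.comp s a j) =
      ∑ k, c.g a b V' ha hb j k * secRes X (le_inf hV hb) (c.comp s b k) :=
  (s : c.glueSubmodule V).2 a b V' hV ha hb j

/-- Components of a restricted section. [folklore] -/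
@[simp]
lemma comp_map {V V' : X.Opens} (i : V' ⟶ V) (s : Γ(c.glued, V)) (a : ι) (j : c.I a) :
    c.comp (c.glued.presheaf.map i.op s) a j =
      secRes X (inf_le_inf_right (c.U a) i.le) (c.comp s a j) :=
  rfl

/-- Components of a sum. [folklore] -/
@[simp]
lemma comp_add {V : X.Opens} (s t : Γ(c.glued, V)) (a : ι) (j : c.I a) :
    c.comp (s + t) a j = c.comp s a j + c.comp t a j := rfl

/-- Components of zero. [folklore] -/
@[simp]
lemma comp_zero {V : X.Opens} (a : ι) (j : c.I a) : c.comp (0 : Γ(c.glued, V)) a j = 0 := rfl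

/-- Components of a scalar multiple. [folklore] -/
@[simp]
lemma comp_smul {V : X.Opens} (r : Γ(X, V)) (s : Γ(c.glued, V)) (a : ι) (j : c.I a) :
    c.comp (r • s) a j = secRes X (inf_le_left : V ⊓ c.U a ≤ V) r * c.comp s a j := rfl

/-- The `(a, j)`-component as an additive map (so that finite sums are computed componentwise).
[folklore] -/
def compHom (V : X.Opens) (a : ι) (j : c.I a) : Γ(c.glued, V) →+ Γ(X, V ⊓ c.U a) where
  toFun s := c.comp s a j
  map_zero' := rfl
  map_add' _ _ := rfl

/-- Components of a finite sum of sections. [folklore] -/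
lemma comp_sum {V : X.Opens} {κ : Type*} (t : Finset κ) (s : κ → Γ(c.glued, V)) (a : ι)
    (j : c.I a) : c.comp (∑ k ∈ t, s k) a j = ∑ k ∈ t, c.comp (s k) a j :=
  map_sum (c.compHom V a j) s t

/-- A section of the glued module from a glue family. [folklore] -/
def mkSection (V : X.Opens) (s : ∀ a, c.I a → Γ(X, V ⊓ c.U a)) (hs : c.IsGlueFamily V s) :
    Γ(c.glued, V) :=
  (⟨s, hs⟩ : c.glueSubmodule V)

/-- Components of `mkSection`. [folklore] -/
@[simp]
lemma comp_mkSection (V : X.Opens) (s : ∀ a, c.I a → Γ(X, V ⊓ c.U a))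
    (hs : c.IsGlueFamily V s) (a : ι) (j : c.I a) :
    c.comp (c.mkSection V s hs) a j = s a j := rfl

/-! ### The column sections and the local frames -/

/-- **The column section `t_{b,k} = (g_{ab} e_k)_a` of the glued module over `V ≤ U_b`**: its
`a`-component is the `k`-th column of `g_{ab}`. [folklore] -/
def gen (b : ι) (k : c.I b) (V : X.Opens) (h : V ≤ c.U b) : Γ(c.glued, V) :=
  c.mkSection V (fun a j => c.g a b (V ⊓ c.U a) inf_le_right (inf_le_left.trans h) j k)
    fun a a' V' hV ha ha' j => by
      rw [c.map_g_apply]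
      simp_rw [c.map_g_apply]
      exact (c.sum_g_mul_g a a' b V' ha ha' (hV.trans h) j k).symm

/-- Components of the column sections. [folklore] -/
@[simp]
lemma comp_gen (b : ι) (k : c.I b) (V : X.Opens) (h : V ≤ c.U b) (a : ι) (j : c.I a) :
    c.comp (c.gen b k V h) a j = c.g a b (V ⊓ c.U a) inf_le_right (inf_le_left.trans h) j k := rfl

/-- Column sections restrict to column sections. [folklore] -/
lemma map_gen (b : ι) (k : c.I b) {V V' : X.Opens} (h : V ≤ c.U b) (i : V' ⟶ V) :
    c.glued.presheaf.map i.op (c.gen b k V h) = c.gen b k V' (i.le.trans h) := by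
  ext a j
  rw [comp_map, comp_gen, comp_gen, c.map_g_apply]

/-- **Change of columns: `t_{b',l} = ∑_k (g_{bb'})_{kl} t_{b,k}`** over `V ≤ U_b ⊓ U_{b'}`.
[folklore] -/
theorem gen_eq_sum_smul_gen (b b' : ι) (l : c.I b') (V : X.Opens) (hb : V ≤ c.U b)
    (hb' : V ≤ c.U b') :
    c.gen b' l V hb' = ∑ k, c.g b b' V hb hb' k l • c.gen b k V hb := by
  ext a j
  rw [comp_gen, comp_sum]
  simp_rw [comp_smul, comp_gen, c.map_g_apply]
  rw [← c.sum_g_mul_g a b b' (V ⊓ c.U a) inf_le_right (inf_le_left.trans hb)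
    (inf_le_left.trans hb') j l]
  exact Finset.sum_congr rfl fun k _ => mul_comm _ _

/-- **Every section over `V ≤ U_b` is `∑_k (s_b)_k t_{b,k}`.** [folklore] -/
theorem eq_sum_smul_gen (b : ι) (V : X.Opens) (h : V ≤ c.U b) (s : Γ(c.glued, V)) :
    s = ∑ k, secRes X (le_inf le_rfl h : V ≤ V ⊓ c.U b) (c.comp s b k) • c.gen b k V h := by
  ext a j
  rw [comp_sum]
  simp_rw [comp_smul, comp_gen, secRes_secRes]
  have hr := c.comp_rel s a b (V ⊓ c.U a) inf_le_left inf_le_right (inf_le_left.trans h) j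
  rw [show secRes X (le_inf inf_le_left inf_le_right : V ⊓ c.U a ≤ V ⊓ c.U a) (c.comp s a j) =
    c.comp s a j from secRes_self _] at hr
  rw [hr]
  exact Finset.sum_congr rfl fun k _ => mul_comm _ _

end MatrixCocycle

end Literature.AlgebraicGeometry.Modules

end
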